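import Summits.CriticalPhenomena.PercolationContinuityZ3.Theorems.PercNearOneGluingNoHeavyLowerTailWorstPairExchangeCex
import HarnessLib

/-!
# `NoHeavyLowerTail` (stmt-CriticalPhenomena-4575) — the MASTER GLUING RULE fails for two glued vertices
# (certified 8-vertex, 13-pair witness)

Support file (prover `prim-hp-1`, hull-port / coupling line; `--supports stmt-CriticalPhenomena-4575`).  Computational
(`native_decide` on `2¹³`-term exact rational sums; evaluation pattern of `…LocalizedSelectionCex.lean`).  No definitions,
no named facts, no sorries.

**Background.**  With `N_x = |{a ∈ A : x ↔ a}|` (a relay counts itself), the T-form (guarded cumulative isolation, pre-FKG CIL) at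
a vertex `x` with witness relay `c` is `T(H, x, c) : μ{1 ≤ N_x ≤ j} ≤ μ{1 ≤ N_x ∧ N_c ≤ j}`.  The lead's MASTER GLUING RULE
(memo run/shared/lean/prim/prim-nh-lead-4575/LEAD-GEN3.md §8; 0 / 396 000 random premise-instances) proposed that for every set `S`
of non-relay vertices glued into one vertex `s*`, `[∀ y ∈ S, T(H, y, c)] ⇒ T(H/S, s*, c)`; with the star decomposition it would give
`VALID(G,o) ⊇ ⋂_{y ∼ o} VALID(G−o, y)` and CIL on the path-domination class.  Read in `H` for `S = {u, v}`: `N_{s*} = |{a : u ↔ a ∨ v ↔ a}|`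
and the glued lightness of `c` is `N_{s*}` if `c ↔ u ∨ c ↔ v`, else `N_c` — the shape of `WitnessSeparated.tform_glued_of_tform`
(file `…TformWitnessSeparated`), which PROVES the rule when `c` separates `u` from `v`.

**This file: the rule is false in general, already for `|S| = 2`.**  Witness (crux memo HULLPORT-COUPLING.md §30; found by annealing
on the localized form of §28, simplified, verified by exact enumeration and by an independent glued-edge evaluation): `Fin 8`, `u = 0`,
`v = 1`, `c = 2`, relays `A = {2,4,5,6,7}`, `j = 2`; weights `w(0,3) = 1/2`, `w(0,7) = 4/5`, `w(1,3) = 1/2`, `w(1,7) = 17/20`,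
`w(2,3) = 7/10`, `w(2,4) = 1/4`, `w(2,6) = 1/2`, `w(2,7) = 49/50`, `w(3,4) = 3/4`, `w(4,5) = w(4,6) = w(5,6) = 1`, `w(5,7) = 1/10`, all
other pairs `0` (relays `4,5,6` a glued heavy block, `3` a Steiner hub next to `u, v, c` and the block, `7` a relay next to `u, v, c`).
Exactly: `T(H,u,c)` holds with slack `0.001606734375`, `T(H,v,c)` with slack `0.00030571875`, and the glued T-form FAILS with slack
`−0.001133953125`.

* `MasterGluingPairCex.cnt_reachTable`, `cnt_reachTable_union` — relay counts read off reach tables;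
* `real_attLight`, `real_attWitLight`, `real_gluedAttLight`, `real_gluedAttWitLight` — the six masses as exact weighted counts;
* `masterGluingPair_cex` — the instance;  `masterGluingPair_false` — `¬`MGR for two glued vertices, in the shape of
  `WitnessSeparated.tform_glued_of_tform` without the separation hypothesis;
* `masterGluingPair_cex_relayNeighboured`, `masterGluingPair_false_relayNeighboured` — the same with `u, v` relay-neighboured (7-vertex witness).
-/

namespace Summit.CriticalPhenomena.PercolationContinuityZ3.Theorems

open MeasureTheory
open Literature.Probability.LatticeModels Literature.Probability.Percolation
open Summit.CriticalPhenomena.PercolationContinuityZ3.Theorems.AdditiveGluing.Negative.Cert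
open scoped Classical

set_option maxHeartbeats 400000

namespace MasterGluingPairCex

open WorstPairExchangeCex (real_eq_wcount)

/-- The relay count read off the reach table of a configuration is the relay count of the cluster. [this file] -/
theorem cnt_reachTable (ω : List (Fin 8 × Fin 8)) (x : Fin 8) :
    ((({2, 4, 5, 6, 7} : Finset (Fin 8))).filter fun q : Fin 8 => ((reachTable 8 ω).getD x.val 0).testBit q.val = true).card =
      ((({2, 4, 5, 6, 7} : Finset (Fin 8))).filter fun q => (↑(Eset ω) : Set (Sym2 (Fin 8))) ∈ openConn x q).card := by
  congr 1
  exact Finset.filter_congr fun q _ => testBit_reachTable_iff_mem_openConn ω x q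

/-- The relay count of the glued pair of clusters of `x, y` read off the reach table. [this file] -/
theorem cnt_reachTable_union (ω : List (Fin 8 × Fin 8)) (x y : Fin 8) :
    ((({2, 4, 5, 6, 7} : Finset (Fin 8))).filter fun q : Fin 8 =>
        (((reachTable 8 ω).getD x.val 0).testBit q.val || ((reachTable 8 ω).getD y.val 0).testBit q.val) = true).card =
      ((({2, 4, 5, 6, 7} : Finset (Fin 8))).filter fun q =>
        (↑(Eset ω) : Set (Sym2 (Fin 8))) ∈ openConn x q ∨ (↑(Eset ω) : Set (Sym2 (Fin 8))) ∈ openConn y q).card := by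
  congr 1
  refine Finset.filter_congr fun q _ => ?_
  rw [Bool.or_eq_true, testBit_reachTable_iff_mem_openConn ω x q, testBit_reachTable_iff_mem_openConn ω y q]

/-- `μ{1 ≤ N_x ≤ 2}` as an exact weighted count. [this file] -/
theorem real_attLight {l : List (Fin 8 × Fin 8 × ℚ)} (hnd : (wPairs l).Nodup) (hq : ∀ e ∈ l, 0 ≤ e.2.2 ∧ e.2.2 ≤ 1) (x : Fin 8) :
    (prodBernoulli (wOfList l)).real
        {ω : BondConfig (Fin 8) | 1 ≤ ((({2, 4, 5, 6, 7} : Finset (Fin 8))).filter fun q => ω ∈ openConn x q).card ∧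
          ((({2, 4, 5, 6, 7} : Finset (Fin 8))).filter fun q => ω ∈ openConn x q).card ≤ 2} =
      ((((wtabs 8 l).map fun t => if
          (Nat.ble 1 (((({2, 4, 5, 6, 7} : Finset (Fin 8))).filter fun q : Fin 8 => ((t.1).getD x.val 0).testBit q.val = true).card) &&
            Nat.ble (((({2, 4, 5, 6, 7} : Finset (Fin 8))).filter fun q : Fin 8 => ((t.1).getD x.val 0).testBit q.val = true).card) 2)
          then t.2 else 0).sum : ℚ) : ℝ) := by
  refine real_eq_wcount hnd hq (fun tb =>
      Nat.ble 1 (((({2, 4, 5, 6, 7} : Finset (Fin 8))).filter fun q : Fin 8 => ((tb).getD x.val 0).testBit q.val = true).card) &&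
        Nat.ble (((({2, 4, 5, 6, 7} : Finset (Fin 8))).filter fun q : Fin 8 => ((tb).getD x.val 0).testBit q.val = true).card) 2) _
    fun ω => ?_
  have hcx : ((({2, 4, 5, 6, 7} : Finset (Fin 8))).filter fun q : Fin 8 => (((reachTable 8 ω)).getD x.val 0).testBit q.val = true).card =
      ((({2, 4, 5, 6, 7} : Finset (Fin 8))).filter fun q => (↑(Eset ω) : Set (Sym2 (Fin 8))) ∈ openConn x q).card :=
    cnt_reachTable ω x
  rw [hcx, Bool.and_eq_true, Nat.ble_eq, Nat.ble_eq, Set.mem_setOf_eq]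

/-- `μ{1 ≤ N_x, N_2 ≤ 2}` as an exact weighted count. [this file] -/
theorem real_attWitLight {l : List (Fin 8 × Fin 8 × ℚ)} (hnd : (wPairs l).Nodup) (hq : ∀ e ∈ l, 0 ≤ e.2.2 ∧ e.2.2 ≤ 1)
    (x : Fin 8) :
    (prodBernoulli (wOfList l)).real
        {ω : BondConfig (Fin 8) | 1 ≤ ((({2, 4, 5, 6, 7} : Finset (Fin 8))).filter fun q => ω ∈ openConn x q).card ∧
          ((({2, 4, 5, 6, 7} : Finset (Fin 8))).filter fun q => ω ∈ openConn (2 : Fin 8) q).card ≤ 2} =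
      ((((wtabs 8 l).map fun t => if
          (Nat.ble 1 (((({2, 4, 5, 6, 7} : Finset (Fin 8))).filter fun q : Fin 8 => ((t.1).getD x.val 0).testBit q.val = true).card) &&
            Nat.ble (((({2, 4, 5, 6, 7} : Finset (Fin 8))).filter fun q : Fin 8 => ((t.1).getD 2 0).testBit q.val = true).card) 2)
          then t.2 else 0).sum : ℚ) : ℝ) := by
  refine real_eq_wcount hnd hq (fun tb =>
      Nat.ble 1 (((({2, 4, 5, 6, 7} : Finset (Fin 8))).filter fun q : Fin 8 => ((tb).getD x.val 0).testBit q.val = true).card) &&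
        Nat.ble (((({2, 4, 5, 6, 7} : Finset (Fin 8))).filter fun q : Fin 8 => ((tb).getD 2 0).testBit q.val = true).card) 2) _
    fun ω => ?_
  have hcx : ((({2, 4, 5, 6, 7} : Finset (Fin 8))).filter fun q : Fin 8 => (((reachTable 8 ω)).getD x.val 0).testBit q.val = true).card =
      ((({2, 4, 5, 6, 7} : Finset (Fin 8))).filter fun q => (↑(Eset ω) : Set (Sym2 (Fin 8))) ∈ openConn x q).card :=
    cnt_reachTable ω x
  have hc2 : ((({2, 4, 5, 6, 7} : Finset (Fin 8))).filter fun q : Fin 8 => (((reachTable 8 ω)).getD 2 0).testBit q.val = true).card =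
      ((({2, 4, 5, 6, 7} : Finset (Fin 8))).filter fun q => (↑(Eset ω) : Set (Sym2 (Fin 8))) ∈ openConn 2 q).card :=
    cnt_reachTable ω 2
  rw [hcx, hc2, Bool.and_eq_true, Nat.ble_eq, Nat.ble_eq, Set.mem_setOf_eq]

/-- `μ{1 ≤ N_U ≤ 2}` (`U = C(0) ∪ C(1)`) as an exact weighted count. [this file] -/
theorem real_gluedAttLight {l : List (Fin 8 × Fin 8 × ℚ)} (hnd : (wPairs l).Nodup) (hq : ∀ e ∈ l, 0 ≤ e.2.2 ∧ e.2.2 ≤ 1) :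
    (prodBernoulli (wOfList l)).real
        {ω : BondConfig (Fin 8) |
          1 ≤ ((({2, 4, 5, 6, 7} : Finset (Fin 8))).filter fun q => ω ∈ openConn (0 : Fin 8) q ∨ ω ∈ openConn (1 : Fin 8) q).card ∧
          ((({2, 4, 5, 6, 7} : Finset (Fin 8))).filter fun q => ω ∈ openConn (0 : Fin 8) q ∨ ω ∈ openConn (1 : Fin 8) q).card ≤ 2} =
      ((((wtabs 8 l).map fun t => if
          (Nat.ble 1 (((({2, 4, 5, 6, 7} : Finset (Fin 8))).filter fun q : Fin 8 =>
              (((t.1).getD 0 0).testBit q.val || ((t.1).getD 1 0).testBit q.val) = true).card) &&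
            Nat.ble (((({2, 4, 5, 6, 7} : Finset (Fin 8))).filter fun q : Fin 8 =>
              (((t.1).getD 0 0).testBit q.val || ((t.1).getD 1 0).testBit q.val) = true).card) 2)
          then t.2 else 0).sum : ℚ) : ℝ) := by
  refine real_eq_wcount hnd hq (fun tb =>
      Nat.ble 1 (((({2, 4, 5, 6, 7} : Finset (Fin 8))).filter fun q : Fin 8 =>
          (((tb).getD 0 0).testBit q.val || ((tb).getD 1 0).testBit q.val) = true).card) &&
        Nat.ble (((({2, 4, 5, 6, 7} : Finset (Fin 8))).filter fun q : Fin 8 =>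
          (((tb).getD 0 0).testBit q.val || ((tb).getD 1 0).testBit q.val) = true).card) 2) _
    fun ω => ?_
  have hcU : ((({2, 4, 5, 6, 7} : Finset (Fin 8))).filter fun q : Fin 8 =>
        ((((reachTable 8 ω)).getD 0 0).testBit q.val || (((reachTable 8 ω)).getD 1 0).testBit q.val) = true).card =
      ((({2, 4, 5, 6, 7} : Finset (Fin 8))).filter fun q =>
        (↑(Eset ω) : Set (Sym2 (Fin 8))) ∈ openConn 0 q ∨ (↑(Eset ω) : Set (Sym2 (Fin 8))) ∈ openConn 1 q).card :=
    cnt_reachTable_union ω 0 1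
  rw [hcU, Bool.and_eq_true, Nat.ble_eq, Nat.ble_eq, Set.mem_setOf_eq]

/-- `μ{1 ≤ N_U, N'_2 ≤ 2}` with the glued lightness `N'_2` (`= N_U` if `2 ↔ 0 ∨ 2 ↔ 1`, else `N_2`) as an exact weighted count.
[this file] -/
theorem real_gluedAttWitLight {l : List (Fin 8 × Fin 8 × ℚ)} (hnd : (wPairs l).Nodup) (hq : ∀ e ∈ l, 0 ≤ e.2.2 ∧ e.2.2 ≤ 1) :
    (prodBernoulli (wOfList l)).real
        {ω : BondConfig (Fin 8) |
          1 ≤ ((({2, 4, 5, 6, 7} : Finset (Fin 8))).filter fun q => ω ∈ openConn (0 : Fin 8) q ∨ ω ∈ openConn (1 : Fin 8) q).card ∧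
          (if ω ∈ openConn (2 : Fin 8) (0 : Fin 8) ∨ ω ∈ openConn (2 : Fin 8) (1 : Fin 8)
            then ((({2, 4, 5, 6, 7} : Finset (Fin 8))).filter fun q => ω ∈ openConn (0 : Fin 8) q ∨ ω ∈ openConn (1 : Fin 8) q).card
            else ((({2, 4, 5, 6, 7} : Finset (Fin 8))).filter fun q => ω ∈ openConn (2 : Fin 8) q).card) ≤ 2} =
      ((((wtabs 8 l).map fun t => if
          (Nat.ble 1 (((({2, 4, 5, 6, 7} : Finset (Fin 8))).filter fun q : Fin 8 =>
              (((t.1).getD 0 0).testBit q.val || ((t.1).getD 1 0).testBit q.val) = true).card) &&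
            Nat.ble (bif (((t.1).getD 2 0).testBit 0 || ((t.1).getD 2 0).testBit 1)
              then ((({2, 4, 5, 6, 7} : Finset (Fin 8))).filter fun q : Fin 8 =>
                (((t.1).getD 0 0).testBit q.val || ((t.1).getD 1 0).testBit q.val) = true).card
              else ((({2, 4, 5, 6, 7} : Finset (Fin 8))).filter fun q : Fin 8 => ((t.1).getD 2 0).testBit q.val = true).card) 2)
          then t.2 else 0).sum : ℚ) : ℝ) := by
  refine real_eq_wcount hnd hq (fun tb =>
      Nat.ble 1 (((({2, 4, 5, 6, 7} : Finset (Fin 8))).filter fun q : Fin 8 =>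
          (((tb).getD 0 0).testBit q.val || ((tb).getD 1 0).testBit q.val) = true).card) &&
        Nat.ble (bif (((tb).getD 2 0).testBit 0 || ((tb).getD 2 0).testBit 1)
          then ((({2, 4, 5, 6, 7} : Finset (Fin 8))).filter fun q : Fin 8 =>
            (((tb).getD 0 0).testBit q.val || ((tb).getD 1 0).testBit q.val) = true).card
          else ((({2, 4, 5, 6, 7} : Finset (Fin 8))).filter fun q : Fin 8 => ((tb).getD 2 0).testBit q.val = true).card) 2) _
    fun ω => ?_
  have hcU : ((({2, 4, 5, 6, 7} : Finset (Fin 8))).filter fun q : Fin 8 =>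
        ((((reachTable 8 ω)).getD 0 0).testBit q.val || (((reachTable 8 ω)).getD 1 0).testBit q.val) = true).card =
      ((({2, 4, 5, 6, 7} : Finset (Fin 8))).filter fun q =>
        (↑(Eset ω) : Set (Sym2 (Fin 8))) ∈ openConn 0 q ∨ (↑(Eset ω) : Set (Sym2 (Fin 8))) ∈ openConn 1 q).card :=
    cnt_reachTable_union ω 0 1
  have hc2 : ((({2, 4, 5, 6, 7} : Finset (Fin 8))).filter fun q : Fin 8 => (((reachTable 8 ω)).getD 2 0).testBit q.val = true).card =
      ((({2, 4, 5, 6, 7} : Finset (Fin 8))).filter fun q => (↑(Eset ω) : Set (Sym2 (Fin 8))) ∈ openConn 2 q).card :=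
    cnt_reachTable ω 2
  have h20 : ((reachTable 8 ω).getD 2 0).testBit 0 = true ↔ (↑(Eset ω) : Set (Sym2 (Fin 8))) ∈ openConn (2 : Fin 8) (0 : Fin 8) :=
    testBit_reachTable_iff_mem_openConn ω 2 0
  have h21 : ((reachTable 8 ω).getD 2 0).testBit 1 = true ↔ (↑(Eset ω) : Set (Sym2 (Fin 8))) ∈ openConn (2 : Fin 8) (1 : Fin 8) :=
    testBit_reachTable_iff_mem_openConn ω 2 1
  rw [hcU, hc2, Bool.and_eq_true, Nat.ble_eq, Nat.ble_eq, Set.mem_setOf_eq]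
  have hb : (((reachTable 8 ω).getD 2 0).testBit 0 || ((reachTable 8 ω).getD 2 0).testBit 1) = true ↔
      ((↑(Eset ω) : Set (Sym2 (Fin 8))) ∈ openConn (2 : Fin 8) (0 : Fin 8) ∨
        (↑(Eset ω) : Set (Sym2 (Fin 8))) ∈ openConn (2 : Fin 8) (1 : Fin 8)) := by
    rw [Bool.or_eq_true, h20, h21]
  by_cases hP : (↑(Eset ω) : Set (Sym2 (Fin 8))) ∈ openConn (2 : Fin 8) (0 : Fin 8) ∨
      (↑(Eset ω) : Set (Sym2 (Fin 8))) ∈ openConn (2 : Fin 8) (1 : Fin 8)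
  · have hbt : (((reachTable 8 ω).getD 2 0).testBit 0 || ((reachTable 8 ω).getD 2 0).testBit 1) = true := hb.2 hP
    rw [if_pos hP, hbt, cond_true]
  · have hbf : (((reachTable 8 ω).getD 2 0).testBit 0 || ((reachTable 8 ω).getD 2 0).testBit 1) = false := by
      cases h : (((reachTable 8 ω).getD 2 0).testBit 0 || ((reachTable 8 ω).getD 2 0).testBit 1)
      · rfl
      · exact absurd (hb.1 h) hP
    rw [if_neg hP, hbf, cond_false]

/-- **From three checkable rational facts to the violating instance** (`u = 0`, `v = 1`, `c = 2`, relays `{2,4,5,6,7}`, `j = 2`).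
[this file] -/
theorem violation_of_check (l : List (Fin 8 × Fin 8 × ℚ)) (hnd : (wPairs l).Nodup)
    (hq : ∀ e ∈ l, 0 ≤ e.2.2 ∧ e.2.2 ≤ 1)
    (hu : ((wtabs 8 l).map fun t => if
          (Nat.ble 1 (((({2, 4, 5, 6, 7} : Finset (Fin 8))).filter fun q : Fin 8 => ((t.1).getD (0 : Fin 8).val 0).testBit q.val = true).card) &&
            Nat.ble (((({2, 4, 5, 6, 7} : Finset (Fin 8))).filter fun q : Fin 8 => ((t.1).getD (0 : Fin 8).val 0).testBit q.val = true).card) 2)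
          then t.2 else 0).sum ≤
      ((wtabs 8 l).map fun t => if
          (Nat.ble 1 (((({2, 4, 5, 6, 7} : Finset (Fin 8))).filter fun q : Fin 8 => ((t.1).getD (0 : Fin 8).val 0).testBit q.val = true).card) &&
            Nat.ble (((({2, 4, 5, 6, 7} : Finset (Fin 8))).filter fun q : Fin 8 => ((t.1).getD 2 0).testBit q.val = true).card) 2)
          then t.2 else 0).sum)
    (hv : ((wtabs 8 l).map fun t => if
          (Nat.ble 1 (((({2, 4, 5, 6, 7} : Finset (Fin 8))).filter fun q : Fin 8 => ((t.1).getD (1 : Fin 8).val 0).testBit q.val = true).card) &&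
            Nat.ble (((({2, 4, 5, 6, 7} : Finset (Fin 8))).filter fun q : Fin 8 => ((t.1).getD (1 : Fin 8).val 0).testBit q.val = true).card) 2)
          then t.2 else 0).sum ≤
      ((wtabs 8 l).map fun t => if
          (Nat.ble 1 (((({2, 4, 5, 6, 7} : Finset (Fin 8))).filter fun q : Fin 8 => ((t.1).getD (1 : Fin 8).val 0).testBit q.val = true).card) &&
            Nat.ble (((({2, 4, 5, 6, 7} : Finset (Fin 8))).filter fun q : Fin 8 => ((t.1).getD 2 0).testBit q.val = true).card) 2)
          then t.2 else 0).sum)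
    (hU : ((wtabs 8 l).map fun t => if
          (Nat.ble 1 (((({2, 4, 5, 6, 7} : Finset (Fin 8))).filter fun q : Fin 8 =>
              (((t.1).getD 0 0).testBit q.val || ((t.1).getD 1 0).testBit q.val) = true).card) &&
            Nat.ble (bif (((t.1).getD 2 0).testBit 0 || ((t.1).getD 2 0).testBit 1)
              then ((({2, 4, 5, 6, 7} : Finset (Fin 8))).filter fun q : Fin 8 =>
              (((t.1).getD 0 0).testBit q.val || ((t.1).getD 1 0).testBit q.val) = true).card
              else ((({2, 4, 5, 6, 7} : Finset (Fin 8))).filter fun q : Fin 8 => ((t.1).getD 2 0).testBit q.val = true).card) 2)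
          then t.2 else 0).sum <
      ((wtabs 8 l).map fun t => if
          (Nat.ble 1 (((({2, 4, 5, 6, 7} : Finset (Fin 8))).filter fun q : Fin 8 =>
              (((t.1).getD 0 0).testBit q.val || ((t.1).getD 1 0).testBit q.val) = true).card) &&
            Nat.ble (((({2, 4, 5, 6, 7} : Finset (Fin 8))).filter fun q : Fin 8 =>
              (((t.1).getD 0 0).testBit q.val || ((t.1).getD 1 0).testBit q.val) = true).card) 2)
          then t.2 else 0).sum) :
    (prodBernoulli (wOfList l)).real
        {ω : BondConfig (Fin 8) | 1 ≤ ((({2, 4, 5, 6, 7} : Finset (Fin 8))).filter fun q => ω ∈ openConn (0 : Fin 8) q).card ∧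
          ((({2, 4, 5, 6, 7} : Finset (Fin 8))).filter fun q => ω ∈ openConn (0 : Fin 8) q).card ≤ 2} ≤
      (prodBernoulli (wOfList l)).real
        {ω : BondConfig (Fin 8) | 1 ≤ ((({2, 4, 5, 6, 7} : Finset (Fin 8))).filter fun q => ω ∈ openConn (0 : Fin 8) q).card ∧
          ((({2, 4, 5, 6, 7} : Finset (Fin 8))).filter fun q => ω ∈ openConn (2 : Fin 8) q).card ≤ 2} ∧
    (prodBernoulli (wOfList l)).real
        {ω : BondConfig (Fin 8) | 1 ≤ ((({2, 4, 5, 6, 7} : Finset (Fin 8))).filter fun q => ω ∈ openConn (1 : Fin 8) q).card ∧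
          ((({2, 4, 5, 6, 7} : Finset (Fin 8))).filter fun q => ω ∈ openConn (1 : Fin 8) q).card ≤ 2} ≤
      (prodBernoulli (wOfList l)).real
        {ω : BondConfig (Fin 8) | 1 ≤ ((({2, 4, 5, 6, 7} : Finset (Fin 8))).filter fun q => ω ∈ openConn (1 : Fin 8) q).card ∧
          ((({2, 4, 5, 6, 7} : Finset (Fin 8))).filter fun q => ω ∈ openConn (2 : Fin 8) q).card ≤ 2} ∧
    (prodBernoulli (wOfList l)).real
        {ω : BondConfig (Fin 8) |
          1 ≤ ((({2, 4, 5, 6, 7} : Finset (Fin 8))).filter fun q => ω ∈ openConn (0 : Fin 8) q ∨ ω ∈ openConn (1 : Fin 8) q).card ∧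
          (if ω ∈ openConn (2 : Fin 8) (0 : Fin 8) ∨ ω ∈ openConn (2 : Fin 8) (1 : Fin 8)
            then ((({2, 4, 5, 6, 7} : Finset (Fin 8))).filter fun q => ω ∈ openConn (0 : Fin 8) q ∨ ω ∈ openConn (1 : Fin 8) q).card
            else ((({2, 4, 5, 6, 7} : Finset (Fin 8))).filter fun q => ω ∈ openConn (2 : Fin 8) q).card) ≤ 2} <
      (prodBernoulli (wOfList l)).real
        {ω : BondConfig (Fin 8) |
          1 ≤ ((({2, 4, 5, 6, 7} : Finset (Fin 8))).filter fun q => ω ∈ openConn (0 : Fin 8) q ∨ ω ∈ openConn (1 : Fin 8) q).card ∧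
          ((({2, 4, 5, 6, 7} : Finset (Fin 8))).filter fun q => ω ∈ openConn (0 : Fin 8) q ∨ ω ∈ openConn (1 : Fin 8) q).card ≤ 2} := by
  refine ⟨?_, ?_, ?_⟩
  · rw [real_attLight hnd hq (0 : Fin 8), real_attWitLight hnd hq (0 : Fin 8)]; exact_mod_cast hu
  · rw [real_attLight hnd hq (1 : Fin 8), real_attWitLight hnd hq (1 : Fin 8)]; exact_mod_cast hv
  · rw [real_gluedAttWitLight hnd hq, real_gluedAttLight hnd hq]; exact_mod_cast hU

end MasterGluingPairCex

open MasterGluingPairCex in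
/-- **The master gluing rule fails for two glued vertices: the instance.**  Weights on `Fin 8` as in the module docstring;
relays `{2,4,5,6,7}`, `j = 2`, `u = 0`, `v = 1`, `c = 2`: both T-forms hold and the glued T-form fails (exact rationals by
`native_decide` over the `2¹³` configurations). [this file] -/
theorem masterGluingPair_cex : ∃ w : Sym2 (Fin 8) → unitInterval,
    (prodBernoulli w).real
        {ω : BondConfig (Fin 8) | 1 ≤ ((({2, 4, 5, 6, 7} : Finset (Fin 8))).filter fun q => ω ∈ openConn (0 : Fin 8) q).card ∧
          ((({2, 4, 5, 6, 7} : Finset (Fin 8))).filter fun q => ω ∈ openConn (0 : Fin 8) q).card ≤ 2} ≤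
      (prodBernoulli w).real
        {ω : BondConfig (Fin 8) | 1 ≤ ((({2, 4, 5, 6, 7} : Finset (Fin 8))).filter fun q => ω ∈ openConn (0 : Fin 8) q).card ∧
          ((({2, 4, 5, 6, 7} : Finset (Fin 8))).filter fun q => ω ∈ openConn (2 : Fin 8) q).card ≤ 2} ∧
    (prodBernoulli w).real
        {ω : BondConfig (Fin 8) | 1 ≤ ((({2, 4, 5, 6, 7} : Finset (Fin 8))).filter fun q => ω ∈ openConn (1 : Fin 8) q).card ∧
          ((({2, 4, 5, 6, 7} : Finset (Fin 8))).filter fun q => ω ∈ openConn (1 : Fin 8) q).card ≤ 2} ≤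
      (prodBernoulli w).real
        {ω : BondConfig (Fin 8) | 1 ≤ ((({2, 4, 5, 6, 7} : Finset (Fin 8))).filter fun q => ω ∈ openConn (1 : Fin 8) q).card ∧
          ((({2, 4, 5, 6, 7} : Finset (Fin 8))).filter fun q => ω ∈ openConn (2 : Fin 8) q).card ≤ 2} ∧
    (prodBernoulli w).real
        {ω : BondConfig (Fin 8) |
          1 ≤ ((({2, 4, 5, 6, 7} : Finset (Fin 8))).filter fun q => ω ∈ openConn (0 : Fin 8) q ∨ ω ∈ openConn (1 : Fin 8) q).card ∧
          (if ω ∈ openConn (2 : Fin 8) (0 : Fin 8) ∨ ω ∈ openConn (2 : Fin 8) (1 : Fin 8)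
            then ((({2, 4, 5, 6, 7} : Finset (Fin 8))).filter fun q => ω ∈ openConn (0 : Fin 8) q ∨ ω ∈ openConn (1 : Fin 8) q).card
            else ((({2, 4, 5, 6, 7} : Finset (Fin 8))).filter fun q => ω ∈ openConn (2 : Fin 8) q).card) ≤ 2} <
      (prodBernoulli w).real
        {ω : BondConfig (Fin 8) |
          1 ≤ ((({2, 4, 5, 6, 7} : Finset (Fin 8))).filter fun q => ω ∈ openConn (0 : Fin 8) q ∨ ω ∈ openConn (1 : Fin 8) q).card ∧
          ((({2, 4, 5, 6, 7} : Finset (Fin 8))).filter fun q => ω ∈ openConn (0 : Fin 8) q ∨ ω ∈ openConn (1 : Fin 8) q).card ≤ 2} :=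
  ⟨_, violation_of_check
    [((0 : Fin 8), (3 : Fin 8), 1/2), (0, 7, 4/5), (1, 3, 1/2), (1, 7, 17/20), (2, 3, 7/10), (2, 4, 1/4), (2, 6, 1/2),
      (2, 7, 49/50), (3, 4, 3/4), (4, 5, 1), (4, 6, 1), (5, 6, 1), (5, 7, 1/10)]
    (by decide)
    (by
      intro e he
      simp only [List.mem_cons, List.not_mem_nil, or_false] at he
      rcases he with rfl | rfl | rfl | rfl | rfl | rfl | rfl | rfl | rfl | rfl | rfl | rfl | rfl <;> norm_num)
    (by native_decide) (by native_decide) (by native_decide)⟩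

/-- **No-go: the master gluing rule is false already for two glued vertices.**  It is false that for every finite weighted graph,
relay set `A`, level `j`, non-relays `u ≠ v` and relay `c ∈ A`, the T-forms `μ{1 ≤ N_u ≤ j} ≤ μ{1 ≤ N_u ∧ N_c ≤ j}` and
`μ{1 ≤ N_v ≤ j} ≤ μ{1 ≤ N_v ∧ N_c ≤ j}` imply the T-form of the glued pair `μ{1 ≤ N_U ≤ j} ≤ μ{1 ≤ N_U ∧ N'_c ≤ j}`
(`N_U = |{a : u ↔ a ∨ v ↔ a}|`, `N'_c = N_U` if `c ↔ u ∨ c ↔ v`, else `N_c` — the conclusion shape of `WitnessSeparated.tform_glued_of_tform`,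
which PROVES it when `c` separates `u` from `v`).  Witness `masterGluingPair_cex`. [this file] -/
theorem masterGluingPair_false :
    ¬ (∀ (n : ℕ) (w : Sym2 (Fin n) → unitInterval) (A : Finset (Fin n)) (j : ℕ) (u v c : Fin n),
      [u, v, c].Nodup → u ∉ A → v ∉ A → c ∈ A →
      (prodBernoulli w).real {ω : BondConfig (Fin n) |
          1 ≤ (A.filter fun a => ω ∈ openConn u a).card ∧ (A.filter fun a => ω ∈ openConn u a).card ≤ j} ≤
        (prodBernoulli w).real {ω : BondConfig (Fin n) |
          1 ≤ (A.filter fun a => ω ∈ openConn u a).card ∧ (A.filter fun a => ω ∈ openConn c a).card ≤ j} →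
      (prodBernoulli w).real {ω : BondConfig (Fin n) |
          1 ≤ (A.filter fun a => ω ∈ openConn v a).card ∧ (A.filter fun a => ω ∈ openConn v a).card ≤ j} ≤
        (prodBernoulli w).real {ω : BondConfig (Fin n) |
          1 ≤ (A.filter fun a => ω ∈ openConn v a).card ∧ (A.filter fun a => ω ∈ openConn c a).card ≤ j} →
      (prodBernoulli w).real {ω : BondConfig (Fin n) |
          1 ≤ (A.filter fun a => ω ∈ openConn u a ∨ ω ∈ openConn v a).card ∧
            (A.filter fun a => ω ∈ openConn u a ∨ ω ∈ openConn v a).card ≤ j} ≤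
        (prodBernoulli w).real {ω : BondConfig (Fin n) |
          1 ≤ (A.filter fun a => ω ∈ openConn u a ∨ ω ∈ openConn v a).card ∧
            (if ω ∈ openConn c u ∨ ω ∈ openConn c v
              then (A.filter fun a => ω ∈ openConn u a ∨ ω ∈ openConn v a).card
              else (A.filter fun a => ω ∈ openConn c a).card) ≤ j}) := by
  intro h
  obtain ⟨w, hTu, hTv, hgt⟩ := masterGluingPair_cex
  have h0 : (0 : Fin 8) ∉ ({2, 4, 5, 6, 7} : Finset (Fin 8)) := by decide
  have h1 : (1 : Fin 8) ∉ ({2, 4, 5, 6, 7} : Finset (Fin 8)) := by decide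
  have h2 : (2 : Fin 8) ∈ ({2, 4, 5, 6, 7} : Finset (Fin 8)) := by decide
  have hle := h 8 w ({2, 4, 5, 6, 7} : Finset (Fin 8)) 2 0 1 2 (by decide) h0 h1 h2 hTu hTv
  exact absurd hle (not_le.2 hgt)

/-! ### The relay-neighboured instance: even two phantoms with only relay neighbours fail -/

open MasterGluingPairCex in
/-- **A second instance, with `u, v` RELAY-NEIGHBOURED** (every positive-weight neighbour of `u = 0` and of `v = 1` is a relay —
the 'pair atom' geometry of the hull-port programme, crux memo HULLPORT-COUPLING.md §33): weights on `Fin 8` (vertex `3` unused)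
`w(0,5) = 1/2`, `w(0,7) = 99/100`, `w(1,2) = 1/2`, `w(1,4) = 1/2`, `w(1,7) = 9/10`, `w(2,4) = 1/2`, `w(2,5) = 9/10`, `w(2,7) = 999/1000`,
`w(4,5) = w(5,6) = 1`, `w(6,7) = 1/2`, all other pairs `0`; relays `{2,4,5,6,7}`, `j = 2`, `c = 2`: both T-forms hold (slacks
`1.126875·10⁻⁵`, `2.82246875·10⁻⁴`) and the glued T-form fails (slack `−2.8078125·10⁻⁵`). [this file] -/
theorem masterGluingPair_cex_relayNeighboured : ∃ w : Sym2 (Fin 8) → unitInterval,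
    (∀ x : Fin 8, w s((0 : Fin 8), x) ≠ 0 → x ∈ ({2, 4, 5, 6, 7} : Finset (Fin 8))) ∧
    (∀ x : Fin 8, w s((1 : Fin 8), x) ≠ 0 → x ∈ ({2, 4, 5, 6, 7} : Finset (Fin 8))) ∧
    (prodBernoulli w).real
        {ω : BondConfig (Fin 8) | 1 ≤ ((({2, 4, 5, 6, 7} : Finset (Fin 8))).filter fun q => ω ∈ openConn (0 : Fin 8) q).card ∧
          ((({2, 4, 5, 6, 7} : Finset (Fin 8))).filter fun q => ω ∈ openConn (0 : Fin 8) q).card ≤ 2} ≤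
      (prodBernoulli w).real
        {ω : BondConfig (Fin 8) | 1 ≤ ((({2, 4, 5, 6, 7} : Finset (Fin 8))).filter fun q => ω ∈ openConn (0 : Fin 8) q).card ∧
          ((({2, 4, 5, 6, 7} : Finset (Fin 8))).filter fun q => ω ∈ openConn (2 : Fin 8) q).card ≤ 2} ∧
    (prodBernoulli w).real
        {ω : BondConfig (Fin 8) | 1 ≤ ((({2, 4, 5, 6, 7} : Finset (Fin 8))).filter fun q => ω ∈ openConn (1 : Fin 8) q).card ∧
          ((({2, 4, 5, 6, 7} : Finset (Fin 8))).filter fun q => ω ∈ openConn (1 : Fin 8) q).card ≤ 2} ≤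
      (prodBernoulli w).real
        {ω : BondConfig (Fin 8) | 1 ≤ ((({2, 4, 5, 6, 7} : Finset (Fin 8))).filter fun q => ω ∈ openConn (1 : Fin 8) q).card ∧
          ((({2, 4, 5, 6, 7} : Finset (Fin 8))).filter fun q => ω ∈ openConn (2 : Fin 8) q).card ≤ 2} ∧
    (prodBernoulli w).real
        {ω : BondConfig (Fin 8) |
          1 ≤ ((({2, 4, 5, 6, 7} : Finset (Fin 8))).filter fun q => ω ∈ openConn (0 : Fin 8) q ∨ ω ∈ openConn (1 : Fin 8) q).card ∧
          (if ω ∈ openConn (2 : Fin 8) (0 : Fin 8) ∨ ω ∈ openConn (2 : Fin 8) (1 : Fin 8)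
            then ((({2, 4, 5, 6, 7} : Finset (Fin 8))).filter fun q => ω ∈ openConn (0 : Fin 8) q ∨ ω ∈ openConn (1 : Fin 8) q).card
            else ((({2, 4, 5, 6, 7} : Finset (Fin 8))).filter fun q => ω ∈ openConn (2 : Fin 8) q).card) ≤ 2} <
      (prodBernoulli w).real
        {ω : BondConfig (Fin 8) |
          1 ≤ ((({2, 4, 5, 6, 7} : Finset (Fin 8))).filter fun q => ω ∈ openConn (0 : Fin 8) q ∨ ω ∈ openConn (1 : Fin 8) q).card ∧
          ((({2, 4, 5, 6, 7} : Finset (Fin 8))).filter fun q => ω ∈ openConn (0 : Fin 8) q ∨ ω ∈ openConn (1 : Fin 8) q).card ≤ 2} := by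
  refine ⟨wOfList [((0 : Fin 8), (5 : Fin 8), 1/2), (0, 7, 99/100), (1, 2, 1/2), (1, 4, 1/2), (1, 7, 9/10), (2, 4, 1/2),
      (2, 5, 9/10), (2, 7, 999/1000), (4, 5, 1), (5, 6, 1), (6, 7, 1/2)], ?_, ?_,
    violation_of_check _ (by decide)
      (by
        intro e he
        simp only [List.mem_cons, List.not_mem_nil, or_false] at he
        rcases he with rfl | rfl | rfl | rfl | rfl | rfl | rfl | rfl | rfl | rfl | rfl <;> norm_num)
      (by native_decide) (by native_decide) (by native_decide)⟩
  · intro x hx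
    fin_cases x <;> first | decide | exact absurd (wOfList_eq_zero _ _ (by decide)) hx
  · intro x hx
    fin_cases x <;> first | decide | exact absurd (wOfList_eq_zero _ _ (by decide)) hx

/-- **No-go, relay-neighboured form: the master gluing rule fails for two glued phantoms even when all their neighbours are
relays.**  Adding the hypotheses "every positive-weight neighbour of `u` and of `v` is a relay" to `masterGluingPair_false` does not
rescue it.  Witness `masterGluingPair_cex_relayNeighboured`. [this file] -/
theorem masterGluingPair_false_relayNeighboured :
    ¬ (∀ (n : ℕ) (w : Sym2 (Fin n) → unitInterval) (A : Finset (Fin n)) (j : ℕ) (u v c : Fin n),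
      [u, v, c].Nodup → u ∉ A → v ∉ A → c ∈ A →
      (∀ x, w s(u, x) ≠ 0 → x ∈ A) → (∀ x, w s(v, x) ≠ 0 → x ∈ A) →
      (prodBernoulli w).real {ω : BondConfig (Fin n) |
          1 ≤ (A.filter fun a => ω ∈ openConn u a).card ∧ (A.filter fun a => ω ∈ openConn u a).card ≤ j} ≤
        (prodBernoulli w).real {ω : BondConfig (Fin n) |
          1 ≤ (A.filter fun a => ω ∈ openConn u a).card ∧ (A.filter fun a => ω ∈ openConn c a).card ≤ j} →
      (prodBernoulli w).real {ω : BondConfig (Fin n) |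
          1 ≤ (A.filter fun a => ω ∈ openConn v a).card ∧ (A.filter fun a => ω ∈ openConn v a).card ≤ j} ≤
        (prodBernoulli w).real {ω : BondConfig (Fin n) |
          1 ≤ (A.filter fun a => ω ∈ openConn v a).card ∧ (A.filter fun a => ω ∈ openConn c a).card ≤ j} →
      (prodBernoulli w).real {ω : BondConfig (Fin n) |
          1 ≤ (A.filter fun a => ω ∈ openConn u a ∨ ω ∈ openConn v a).card ∧
            (A.filter fun a => ω ∈ openConn u a ∨ ω ∈ openConn v a).card ≤ j} ≤
        (prodBernoulli w).real {ω : BondConfig (Fin n) |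
          1 ≤ (A.filter fun a => ω ∈ openConn u a ∨ ω ∈ openConn v a).card ∧
            (if ω ∈ openConn c u ∨ ω ∈ openConn c v
              then (A.filter fun a => ω ∈ openConn u a ∨ ω ∈ openConn v a).card
              else (A.filter fun a => ω ∈ openConn c a).card) ≤ j}) := by
  intro h
  obtain ⟨w, hRu, hRv, hTu, hTv, hgt⟩ := masterGluingPair_cex_relayNeighboured
  have h0 : (0 : Fin 8) ∉ ({2, 4, 5, 6, 7} : Finset (Fin 8)) := by decide
  have h1 : (1 : Fin 8) ∉ ({2, 4, 5, 6, 7} : Finset (Fin 8)) := by decide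
  have h2 : (2 : Fin 8) ∈ ({2, 4, 5, 6, 7} : Finset (Fin 8)) := by decide
  have hle := h 8 w ({2, 4, 5, 6, 7} : Finset (Fin 8)) 2 0 1 2 (by decide) h0 h1 h2 hRu hRv hTu hTv
  exact absurd hle (not_le.2 hgt)

end Summit.CriticalPhenomena.PercolationContinuityZ3.Theorems
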